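import Summits.SmoothPoincare4.SmoothPoincare4.Theses.EntropyRung
import Summits.SmoothPoincare4.SmoothPoincare4.Theses.WeylBudget
import Literature.Geometry.Riemannian.HamiltonCurvatureODE
import Literature.Geometry.Riemannian.ChangGurskyYangEuler
import Literature.Geometry.Riemannian.ChernGaussBonnetFour
import Literature.Geometry.Riemannian.HamiltonPCOClassificationKillingHopf
import HarnessLib
import HarnessLib.Audit

/-!
# Line `margerin-cone-hamilton-rails` for crux `EntropyRung.ChangGurskyYang` (stmt-SmoothPoincare4-10834)

PLANNER'S SKELETON v1 (crux-plan, planner-cruxplan-stmt-SmoothPoincare4-10834-margerin-cone-hamilt-0,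
2026-08-16). Card `Cruxes/ChangGurskyYang/Ideas/margerin-cone-hamilton-rails.md` (ideator 1; triage
r1-1, r1-2, r1-3: pass ×3, merge target of `margerin-block-polynomial` and `margerin-certified-cone`).

THE CRUX is VERBATIM the named fact `changGurskyYang_sphere_four` (Chang–Gursky–Yang 2003, Thm. A,
simply connected `scal > 0` case): a closed simply connected 4-manifold carrying a `C^∞` Riemannian
metric with `R > 0` and `∫|W|² dV < 32π²` is diffeomorphic to `S⁴`. The tree proves CGY's §2 as the
reduction to three leaves `hCGB` (Chern–Gauss–Bonnet), `hThm14` (CGY Thm. 1.4, α = 1) and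
`hMargerin` (Margerin 1998, Thm. 1: closed connected `M⁴`, `R > 0`, weak pinching
`WP = (|W|² + 2|E|²)/R² < 1/6` pointwise ⇒ `M ≅ S⁴` or `ℝP⁴`).

THE LINE opens the leaf `hMargerin` on the rails the tree laid for Hamilton 1986/1997: in Hamilton's
block coordinates `(A, B, C)` of the curvature operator (`blockA/B/C`, `HamiltonODE.Blocks`,
`HamiltonODE.field` = the reaction ODE `M' = M² + M^#`) Margerin's cone `WP ≤ c` is
`margerinCone c = {|𝒟|² ≤ c R²}` with `R = tr A + tr C`, `|𝒟|² = ‖A‖² + 2‖B‖² + ‖C‖² − R²/6`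
(the round cone of half-angle 45° about the identity ray when `c = 1/6`), and his fundamental
polynomial is `margerinP2 = R·(|𝒟|²)' − 2|𝒟|²·R' = R³·(WP)'` along the ODE. The leaf becomes:

* STUB 1 `stub_margerinPolynomial` (ALGEBRA = Margerin 1998 Prop. 4 with Lemma 5 / Prop. 28, in the
  MARGIN form the three triagers asked for): for `0 ≤ c < 1/6` there is `σ ∈ (0, 1]` with
  `P₂ ≤ −σ·|𝒟|²·R'` on `margerinCone c` (⟺ `P_β ≤ 0` for `β = 2 − σ`: `β`-weak pinching improves);
* STUB 2 `stub_initialFit` (DICTIONARY + COMPACTNESS): on a closed 4-manifold, `R > 0` and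
  `WP < 1/6` pointwise put the blocks of every orthonormal frame into one pinching set
  `pinchingSet m c K τ = margerinCone c ∩ {R ≥ m} ∩ {|𝒟|² ≤ K R^{2−τ}}` (`m, c, K > 0`, `c < 1/6`);
* STUB 3 `stub_pinchingPreserved` (PDE TRANSFER): given STUB 1's inequality with margin `σ`, every
  `pinchingSet m c K τ` with `0 < τ < σ` is preserved along every Ricci flow of Riemannian metrics on
  a closed 4-manifold (Hamilton's tensor maximum principle `hamilton_maximumPrinciple_curvatureODE`
  applied to a closed convex `B`-even ODE-invariant set — OR Margerin's own scalar route: the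
  PROVED `weakMaximumPrinciple` on `u_β = |𝒟|² R^{−β}`, Margerin Cor. 3);
* STUB 4 `stub_pinchedFlowConvergence` (ENDGAME = Hamilton 1986 criterion 5.2 / Margerin Part VI /
  the noncollapsed round-limit of card `noncollapsed-round-limit`): a closed connected 4-manifold
  whose every Ricci flow from `g₀` stays in one such pinching set carries a metric of constant
  sectional curvature `k > 0`;
* then Killing–Hopf (`killingHopf_quotient_four`, PROVED) and "the only quotient of `S⁴` is `ℝP⁴`"
  (`nonempty_diffeomorph_or_isRealProjectiveSpace_of_orthogonal_quotient`, PROVED) give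
  `S⁴ ∨ ℝP⁴` — `margerin_of_stubs` below, kernel-checked;
* STUB 5 `stub_chernGaussBonnetFour : chernGaussBonnet_four` (named fact, classical XL debt, shared
  with line `cgy-variance-pivot` of crux CompactShrinkerGap) and STUB 6 `stub_thm14Psc` (CGY Thm. 1.4
  in the CONNECTED `scal > 0` shape = Disproof §7 `Thm14LeafPsc` = cards gv-continuity-path /
  gv-weyl-shifted-path verbatim; NOT the paper-false unconnected `hThm14`) are the two untouched
  leaves; `ChangGurskyYang_of : ChangGurskyYang` composes everything into the crux BY NAME, calling the six
  stubs (CGY §2 p. 121 line by line, `χ(M) ≥ 2` and `π₁(ℝP⁴) ≠ 1` being theorems of the tree);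
  `ChangGurskyYang_of_hypotheses` is the same glue with the stub statements as hypotheses, kernel-checked
  with NO `sorry` (axioms propext / Classical.choice / Quot.sound); `ChangGurskyYang_of_weylBudget` restates
  it for the item's second route decl (`WeylBudget.ChangGurskyYang`, the same proposition).

DISPROOF USED (`Cruxes/ChangGurskyYang/Disproof.lean`, cdisprove gen 2 v4, read 2026-08-16): §0
`crux_iff_fact`; §3a `changGurskyYang_false_without_compact` (LANDED
`Theorems/ChangGurskyYang/Negative/WithoutCompactFalse`) — honoured: `[CompactSpace M]` is a binder of
STUBS 2, 3, 4, 5, 6 and is USED in STUB 2 (minimum of `R`, maximum of `WP`), STUB 3 (maximum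
principle on a closed manifold), STUB 4 (`T < ∞`, Myers/compactness of the limit) and STUB 5; §3b
`changGurskyYang_false_without_simplyConnected` (LANDED `…/Negative/WithoutSimplyConnectedFalse`) —
honoured: without `π₁ = 1` the line outputs exactly `S⁴ ∨ ℝP⁴` (`margerin_of_stubs`), and `π₁ = 1`
is spent once, in `ChangGurskyYang_of`, to discard `ℝP⁴` (and inside `χ ≥ 2`); §7 `thm14Leaf_false`
(PAPER) — honoured: STUB 6 is `Thm14LeafPsc`, with `[ConnectedSpace M]`; §7 `MargerinLeafNonStrict`
PAPER-false (`ℂP²`, `S³×S¹` at `WP ≡ 1/6`) — honoured: STUB 1 is stated on the sub-cones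
`c < 1/6` only and STUB 2 produces `c < 1/6` from the STRICT pointwise hypothesis; §4 thresholds
untouched (no constant is changed). Triage r1-2/r1-3 kernel refutations (`TriageR1K3Witness.lean`,
`TriageR1K2Sketch3Antisym.lean`: the polynomial inequality is FALSE off the Bianchi locus, witness
`(I + K, 0, I)`, `F = +144`) — honoured: `margerinCone` carries `A, C` symmetric and `tr A = tr C`.
Negatives index (`ledger negatives --problem SmoothPoincare4`): nothing on this crux's vocabulary.
-/

noncomputable section

open Set Function Module
open scoped Manifold ContDiff Matrix BigOperators Topology ENNReal

namespace Summit.SmoothPoincare4.SmoothPoincare4.Cruxes.ChangGurskyYang.MargerinConeHamiltonRails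

set_option linter.unusedVariables false
set_option linter.dupNamespace false

open Summit.SmoothPoincare4.SmoothPoincare4.Theses.EntropyRung (ChangGurskyYang)
open Literature.Geometry.Riemannian Literature.Geometry.Riemannian.HamiltonODE
open Literature.Geometry.Lorentzian Literature.Geometry.Lorentzian.PseudoRiemannianMetric
open Literature.Topology.FourManifolds

/-- Local notation: the standard `S⁴ ⊂ ℝ⁵`. -/
local notation "𝕊⁴" => (Metric.sphere (0 : EuclideanSpace ℝ (Fin 5)) 1)

/-! ## Margerin's cone in Hamilton's block coordinates (real definitions, card + IdeasSketchR1K1) -/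

/-- Frobenius square norm `Σᵢⱼ Xᵢⱼ²` of a `3 × 3` block. [folklore] -/
def frobSq (X : Matrix (Fin 3) (Fin 3) ℝ) : ℝ := ∑ i, ∑ j, X i j ^ 2

/-- The `(0,4)`-pairing of block triples `⟨A, A'⟩ + 2⟨B, B'⟩ + ⟨C, C'⟩` (the blocks are the matrix
of `Rm` on bivectors of norm `√2`, so the off-diagonal block counts twice).
[cite: Hamilton1986, §6, p. 165] -/
def pairing (p q : Blocks) : ℝ :=
  (∑ i, ∑ j, p.1 i j * q.1 i j) + 2 * (∑ i, ∑ j, p.2.1 i j * q.2.1 i j) +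
    ∑ i, ∑ j, p.2.2 i j * q.2.2 i j

/-- Scalar curvature of a block triple in the tree's normalisation: `R = tr A + tr C`
(unit `S⁴`: `A = C = 2·1`, `R = 12`; unit `S³ × ℝ`: `A = C = 1`, `R = 6`). [cite: Hamilton1986, §6, p. 166] -/
def scal (p : Blocks) : ℝ := p.1.trace + p.2.2.trace

/-- `|Rm|²` in the `(0,4)`-norm: `‖A‖² + 2‖B‖² + ‖C‖²` (unit `S⁴`: `24 = R²/6`).
[cite: ChangGurskyYang2003, (0.2) and Remark 2] -/
def rmNormSq (p : Blocks) : ℝ := frobSq p.1 + 2 * frobSq p.2.1 + frobSq p.2.2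

/-- **Margerin's deviation** `|𝒟|² = |W|² + 2|E|² = |Rm|² − R²/6` — the squared distance of the
block triple to the identity ray `{(λ·1, 0, λ·1)}` in the `(0,4)`-norm (CGY 2003 (0.2): `|Z|²`;
Margerin 1998, Part I, p. 25). [cite: ChangGurskyYang2003, (0.2)] [cite: Margerin1998, Part I, p. 25] -/
def devNormSq (p : Blocks) : ℝ := rmNormSq p - scal p ^ 2 / 6

/-- **Margerin's closed weak-pinching cone `WP ≤ c`** in Hamilton's block coordinates, ON THE
BIANCHI LOCUS (`A`, `C` symmetric, `tr A = tr C` — load-bearing: off the locus the polynomial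
inequality of STUB 1 is kernel-refuted, `TriageR1K3Witness.lean`), with `R ≥ 0`:
`|𝒟|² ≤ c·R²`. For `c = 1/6` this is the round cone of half-angle `45°` about the identity ray
(`|Rm|² ≤ R²/3 = 2·|scalar part|²`); `(ℂP², g_FS)` and `S³ × ℝ` lie on its boundary.
[cite: Margerin1998, Thm. 1 and Part I, p. 25] [cite: ChangGurskyYang2003, (0.2)] -/
def margerinCone (c : ℝ) : Set Blocks :=
  {p | p.1.IsSymm ∧ p.2.2.IsSymm ∧ p.1.trace = p.2.2.trace ∧ 0 ≤ scal p ∧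
    devNormSq p ≤ c * scal p ^ 2}

/-- **Margerin's fundamental polynomial at `β = 2`, ODE level**: along Hamilton's ODE
`p' = field p` one has `(|𝒟|²)' = 2⟨p, p'⟩ − R R'/3` and `R' = scal (field p) = (tr A)² + (tr C)² + 2‖B‖²`
(`trace_field_fst`), and `margerinP2 p = R·(|𝒟|²)' − 2·|𝒟|²·R' = R³ · (WP)'`. Quartic in the 21
block coordinates (cubic on the slice `R = 6` in the coordinates `A = 1 + α`, `C = 1 + γ`, `B = b`:
`−6·Φ_c`, `Φ_c = 6(‖α‖² − tr α³) + 6(‖γ‖² − tr γ³) + (4 + 24c)‖b‖² − 6⟨α, bbᵀ⟩ − 6⟨γ, bᵀb⟩ − 24 det b`,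
re-derived independently by triage r1-2). Margerin's `P_β = R·(|𝒟|²)' − β·|𝒟|²·R' = margerinP2 + (2 − β)·|𝒟|²·R'`.
[cite: Margerin1998, Part I, Prop. 4, Lemma 5, Cor. 3 (pp. 26–29) and Prop. 28 (p. 58)] -/
def margerinP2 (p : Blocks) : ℝ :=
  scal p * (2 * pairing p (field p) - scal p * scal (field p) / 3) -
    2 * devNormSq p * scal (field p)

/-- **The `β`-weak-pinching sets** `Z(m, c, K, τ) = margerinCone c ∩ {R ≥ m} ∩ {|𝒟|² ≤ K·R^{2−τ}}`
(`β = 2 − τ`): Margerin's improving pinching `|𝒟|² ≤ K·scal^β` (Prop. 4) inside the cone `WP ≤ c`,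
cut off below by `R ≥ m > 0` (preserved: `R' ≥ 0` along the ODE, `R_min` non-decreasing along the
flow) so that the sets avoid the apex. They are Hamilton pinching sets in the sense of Hamilton
1986, Def. 5.1: closed, convex (`√|𝒟|²` is the distance to a line, `√K·R^{1−τ/2}` is concave on
`R ≥ 0` for `τ ≤ 1`), `B ↦ −B` symmetric, ODE-invariant (STUB 1 + STUB 3), and on them
`|Rm̊| ≤ C·R^{1−δ}` with `δ = τ/2`. [cite: Margerin1998, Part I, Prop. 4 (p. 27)]
[cite: Hamilton1986, §5, Def. 5.1 (p. 163)] -/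
def pinchingSet (m c K τ : ℝ) : Set Blocks :=
  margerinCone c ∩ {p | m ≤ scal p ∧ devNormSq p ≤ K * scal p ^ (2 - τ)}

/-! ## The registered stubs -/

/-- **STUB 1 — MARGERIN'S POLYNOMIAL INEQUALITY IN MARGIN FORM (the algebraic heart; Margerin 1998,
Prop. 4 with Lemma 5, "largely an algebraic problem … the heart of the paper", Parts II–V).** For
every `0 ≤ c < 1/6` there is `σ ∈ (0, 1]` such that on the closed cone `margerinCone c` (Bianchi
locus, `R ≥ 0`, `|𝒟|² ≤ c R²`) the fundamental polynomial satisfies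
`margerinP2 p ≤ −σ · |𝒟|²(p) · R'(p)`, i.e. `P_{2−σ}(p) ≤ 0`: along Hamilton's ODE, `|𝒟|²/R^{2−σ}` is
non-increasing wherever the solution sits in the cone (and a fortiori `WP = |𝒟|²/R²` is). Both sides
are homogeneous of degree 4, so this is a statement on the compact slice `{R = 1} ∩ margerinCone c`;
near the axis `P₂ = −2‖b‖² − 3(‖α‖² + ‖γ‖²) + O(|𝒟|³) ≤ −|𝒟|²·(1 + o(1))` (triage r1-1), away from it
`P₂ < 0` strictly for `WP ≤ c < 1/6` (Margerin Prop. 4; numerically: max `P₂` on `{WP = w}` is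
`−1.4e−3, −1.7e−3, −8.5e−4, −6.6e−5` at `w = .02, .05, .10, .15`, four independent codes, kit j008113 /
j008125 / j010008 / j010014), so `σ(c) > 0` exists by compactness; `σ(c) → 0` as `c → 1/6` (tangency on
the `ℂP²`, `ℂP̄²`, `S³×ℝ` rays at `c = 1/6`, Prop. 28 — the sharp closed-cone statement `P₂ ≤ 0` on
`margerinCone (1/6)` is the `σ = 0` limit and is deliberately NOT registered: nothing in the line
needs it and its zero set is positive-dimensional). Discharge: by hand along Margerin Parts III–V
(reduction to `A`, `C` diagonal by `SO(3) × SO(3)`, 9 + 4 variables), or by an SOS / nlsat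
certificate of the STRICT margin form on `{R = 1, δ ≤ WP ≤ c}` plus the near-axis quadratic form
(cards margerin-block-polynomial / margerin-certified-cone). FALSE if the symmetry / trace binders of
`margerinCone` are dropped (kernel witness `(I + K, 0, I)`, `TriageR1K3Witness.lean`).
[cite: Margerin1998, Part I, Prop. 4 and Lemma 5 (pp. 27–29); Prop. 28 (p. 58)]
[cite: Huisken1985, §2–3 (the same quantity with the non-sharp constant)] -/
theorem stub_margerinPolynomial :
    ∀ c : ℝ, 0 ≤ c → c < 1 / 6 → ∃ σ : ℝ, 0 < σ ∧ σ ≤ 1 ∧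
      ∀ p ∈ margerinCone c, margerinP2 p ≤ -(σ * (devNormSq p * scal (field p))) := by
  sorry

/-- **STUB 2 — INITIAL FIT (dictionary `WP`/blocks + compactness; cf. `PinchingEstimatesInitialFit.lean`
and `HamiltonPCOPinchingSet.exists_bound_blocks` for the PCO programme).** On a closed smooth
4-manifold with a `C^∞` Riemannian metric `g` of positive scalar curvature and weak pinching
`WP < 1/6` pointwise there are `m > 0`, `0 < c < 1/6` such that for every `τ ∈ [0, 1]` some `K > 0`
puts the Hamilton blocks `(A, B, C)` of EVERY Levi-Civita connection of `g`, at every point in every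
`g`-orthonormal frame, into `pinchingSet m c K τ`. Content: (i) the blocks of a Levi-Civita connection
are symmetric with `tr A = tr C` (`blockA_isSymm`, `blockC_isSymm`, `trace_blockA_eq_trace_blockC`,
PROVED), `tr A + tr C = R(x)` and `|𝒟|²(blocks) = Σ W² + 2 Σ E² = WP(x)·R(x)²` in an orthonormal
frame (`weylNormSqFrame_eq_hamiltonBlocks` PROVED for `|W|² = ‖Å‖² + ‖C̊‖²`; `2|E|² = 2‖B‖²` and the
trace identity are the same bookkeeping; `weakPinching_eq_of_isOrthonormalFrame`; all Levi-Civita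
connections have the same curvature, `IsLeviCivita.eq_leviCivita_holds`); (ii) `R ≥ m := min R > 0`,
`WP ≤ max WP < 1/6` (continuity of `R`, `|W|²`, `|E|²` on the compact `M`; take
`c := max (max WP) (1/12)`), `|𝒟|² ≤ c·R² ≤ c·R_max²`, and `K := c·R_max²/m^{2−τ} + 1`. Checks: round
`S⁴` (`𝒟 = 0`, any `c`), and the statement is vacuous-true on the empty manifold.
[cite: Margerin1998, Part I, p. 25] [cite: ChangGurskyYang2003, (0.2)] [cite: Hamilton1986, §7, Thm. 7.1 (p. 170: "every compact subset … lies in some such pinching set")] -/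
theorem stub_initialFit :
    ∀ (M : Type) [TopologicalSpace M] [T2Space M] [SecondCountableTopology M]
      [ChartedSpace (EuclideanSpace ℝ (Fin 4)) M] [IsManifold (𝓡 4) ∞ M] [CompactSpace M]
      (g : PseudoRiemannianMetric (𝓡 4) ∞ (EuclideanSpace ℝ (Fin 4)) (TangentSpace (𝓡 4) : M → Type _))
      [g.HasLeviCivita], g.IsRiemannian → (∀ x, 0 < g.scalarCurvature x) →
      (∀ x, g.weakPinching x < 1 / 6) →
      ∃ m c : ℝ, 0 < m ∧ 0 < c ∧ c < 1 / 6 ∧ ∀ τ : ℝ, 0 ≤ τ → τ ≤ 1 → ∃ K : ℝ, 0 < K ∧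
        ∀ (cov : CovariantDerivative (𝓡 4) (EuclideanSpace ℝ (Fin 4)) (TangentSpace (𝓡 4) : M → Type _)),
          g.IsLeviCivita cov →
          ∀ (x : M) (e : Fin 4 → TangentSpace (𝓡 4) x), g.IsOrthonormalFrame x e →
            (g.blockA cov x e, g.blockB cov x e, g.blockC cov x e) ∈ pinchingSet m c K τ := by
  sorry

/-- **STUB 3 — THE PINCHING SETS ARE PRESERVED ALONG THE RICCI FLOW (PDE transfer; Margerin 1998
Cor. 3 + Prop. 4 ⇒ "the maximum of the weak pinching is non-increasing" and `β`-weak pinching is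
preserved, p. 27/p. 56; Hamilton 1986 §4–§5).** Let `0 < m`, `0 < c < 1/6`, `0 < K`, `0 < τ < σ ≤ 1`
and suppose STUB 1's inequality holds with margin `σ` on `margerinCone c`. Then along every Ricci
flow `(g, cov)` of Riemannian metrics on `[0, T)` on a closed smooth 4-manifold whose initial blocks
lie in `Z = pinchingSet m c K τ` (every point, every `g 0`-orthonormal frame), the blocks of
`(g t, cov t)` lie in `Z` for all `t ∈ [0, T)`. TWO PROOFS ON OFFER. (T) Tensor route: `Z` is closed
(`R ↦ R^{2−τ}` continuous, `2 − τ > 0`), convex (second-order cone `√|𝒟|² ≤ √c·R`; hypograph of the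
concave `R ↦ √K R^{1−τ/2}`; half-space `R ≥ m`; linear Bianchi locus), `B ↦ −B` symmetric (`|𝒟|²` is
even in `B`), and FORWARD INVARIANT under `HamiltonODE.field`: the Bianchi locus is invariant
(`isInvariant_isSymm`, `isInvariant_trace_eq`, PROVED), `R' = (tr A)² + (tr C)² + 2‖B‖² ≥ R²/2 > 0`
(`trace_field_fst`), and by STUB 1 with `τ < σ` every curved boundary piece is crossed STRICTLY
inwards (`(WP)' = P₂/R³ ≤ −σ·c·R'/R < 0` on `{WP = c}`; `(|𝒟|²R^{τ−2})' = P_{2−τ}/R^{3−τ} ≤ −(σ−τ)K·R'/R < 0`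
on `{|𝒟|² = K R^{2−τ}}`, which misses the axis since `K m^{2−τ} > 0`) — a first-exit-time argument, no
Nagumo needed; then the named fact `hamilton_maximumPrinciple_curvatureODE` (Hamilton 1986 Thm. 4.3 /
Chow–Lu Thm. 3, stated for the printed `+2B^#` field with `B`-even `Z`, exactly as in
`ricciFlow_mem_pcoPinchingFive_of_maximumPrinciple`). (S) Margerin's SCALAR route (the card's point:
consumes only PROVED PDE): `u = |𝒟|²·R^{−β}` satisfies `∂ₜu ≤ Δu + 2(β−1)R⁻¹⟨∇R, ∇u⟩ + R^{−β−1}·P_β(Rm)`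
(Margerin (4), Cor. 3, dropping two non-positive gradient terms; from `∂ₜRm = ΔRm + Rm² + Rm^#` in
coordinates: `CoordCurvatureNormEvolution`, `apply_varRiemAt_of_flow`,
`ricciFlow_hasDerivWithinAt_scalarCurvatureWith`, PROVED) and the PROVED `weakMaximumPrinciple`
(`RicciFlowScalarMaximumPrinciple.lean`, transport term allowed) bounds `max u`, first with `β = 2` on
`{WP ≤ c}` (continuity in `t` keeps `WP` inside `[c, 1/6)` long enough to apply STUB 1), then with
`β = 2 − τ`. Honours Disproof §3a (`[CompactSpace M]` used by either maximum principle).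
[cite: Margerin1998, Part I, Cor. 3 and Prop. 4 (pp. 26–27), p. 56] [cite: Hamilton1986, §4, Thm. 4.3 (p. 162); §5, 5.2 (p. 164)] [cite: ChowLu2004, Thm. 3] -/
theorem stub_pinchingPreserved :
    ∀ (m c K σ τ : ℝ), 0 < m → 0 < c → c < 1 / 6 → 0 < K → 0 < τ → τ < σ → σ ≤ 1 →
      (∀ p ∈ margerinCone c, margerinP2 p ≤ -(σ * (devNormSq p * scal (field p)))) →
      ∀ (M : Type) [TopologicalSpace M] [T2Space M] [SecondCountableTopology M] [CompactSpace M]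
        [ChartedSpace (EuclideanSpace ℝ (Fin 4)) M] [IsManifold (𝓡 4) ∞ M] (T : ℝ)
        (g : ℝ → PseudoRiemannianMetric (𝓡 4) ∞ (EuclideanSpace ℝ (Fin 4))
          (TangentSpace (𝓡 4) : M → Type _))
        (cov : ℝ → CovariantDerivative (𝓡 4) (EuclideanSpace ℝ (Fin 4))
          (TangentSpace (𝓡 4) : M → Type _)),
        IsRicciFlow g cov (Ico 0 T) → (∀ t ∈ Ico 0 T, (g t).IsRiemannian) →
        (∀ (x : M) (e : Fin 4 → TangentSpace (𝓡 4) x), (g 0).IsOrthonormalFrame x e →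
          ((g 0).blockA (cov 0) x e, (g 0).blockB (cov 0) x e, (g 0).blockC (cov 0) x e) ∈
            pinchingSet m c K τ) →
        ∀ t ∈ Ico 0 T, ∀ (x : M) (e : Fin 4 → TangentSpace (𝓡 4) x),
          (g t).IsOrthonormalFrame x e →
            ((g t).blockA (cov t) x e, (g t).blockB (cov t) x e, (g t).blockC (cov t) x e) ∈
              pinchingSet m c K τ := by
  sorry

/-- **STUB 4 — THE ENDGAME: A `β`-PINCHED RICCI FLOW ON A CLOSED CONNECTED 4-MANIFOLD YIELDS A METRIC OF
CONSTANT POSITIVE SECTIONAL CURVATURE (Hamilton 1986, criterion 5.2 for the pinching set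
`pinchingSet m c K τ`; = Margerin 1998 Part VI; = node (H1) of
`hamilton_positiveCurvatureOperator_classification_four_of_constantCurvature` for Margerin's sets instead
of Hamilton's `{M > 0}` sets).** Let `M` be closed connected, `g₀` Riemannian, `0 < m`, `0 < c < 1/6`,
`0 < K`, `0 < τ ≤ 1`, with the blocks of every Levi-Civita connection of `g₀` in `Z = pinchingSet m c K τ`
(STUB 2) and such that EVERY Ricci flow of Riemannian metrics on any `[0, T)` starting at `g₀` keeps its
blocks in `Z` (STUB 3). Then `M` carries a `C^∞` Riemannian metric of constant sectional curvature
`k > 0`. Proof in print: take the maximal flow (`ricciFlow_maximal_existence`, Hamilton 1982 Thm. 14.1 —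
the named-fact debt RF1 shared with the whole PIC programme; `ricciFlow_maximal_existence_iff_shortTime_existence`
PROVED); `R ≥ m > 0` gives `T ≤ 2/m < ∞` (`ricciFlow_singularTime_le_holds`, PROVED) and curvature blow-up
(`ricciFlow_curvature_blowup`); on `Z`: `WP ≤ c < 1/6` ⇒ `Ric ≥ (¼ − √(3c/8))R > 0`, `|Rm|² ≤ R²/3`, and the
scale-breaking pinching `|W|² + 2|E|² ≤ K R^{2−τ}`; then EITHER Hamilton 1982 §§10–17 / 1986 5.2 (gradient
estimate `|∇R| ≤ ηR^{3/2} + C(η)` = Margerin Cor. 25, Myers ⇒ `R_max/R_min → 1` = Lemma 27, `WP → 0`,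
normalised flow converges exponentially to constant curvature), OR the blow-up endgame of card
noncollapsed-round-limit (Perelman no-local-collapsing `perelman_noLocalCollapsing_of_muBounds`, Shi,
Hamilton compactness: the limit has `Z ≡ 0`, `R(x∞) > 0`, Schur ⇒ round, complete ⇒ compact (Myers) ⇒ the
approximating diffeomorphisms are global and pull back a constant-curvature metric to `M`), OR "any
4-dimensional differential sphere theorem" once `WP → 0`, `R_max/R_min → 1` (Margerin p. 57). The
hypothesis `m > 0` excludes the flat torus (where the conclusion fails); connectedness excludes
`S⁴ ⊔ S⁴`-type bookkeeping only. XL: none of the three endgames is in the tree.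
[cite: Hamilton1986, §5, Def. 5.1 and 5.2 (pp. 163–164)] [cite: Margerin1998, Part VI, Cor. 25, Lemmas 26–27 (pp. 53–57)]
[cite: Hamilton1982, §§10–17] [cite: Huisken1985, Thm. 1.1 and §§4–5] -/
theorem stub_pinchedFlowConvergence :
    ∀ (M : Type) [TopologicalSpace M] [T2Space M] [SecondCountableTopology M]
      [ChartedSpace (EuclideanSpace ℝ (Fin 4)) M] [IsManifold (𝓡 4) ∞ M] [CompactSpace M]
      [ConnectedSpace M]
      (g₀ : PseudoRiemannianMetric (𝓡 4) ∞ (EuclideanSpace ℝ (Fin 4)) (TangentSpace (𝓡 4) : M → Type _))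
      (m c K τ : ℝ), g₀.IsRiemannian → 0 < m → 0 < c → c < 1 / 6 → 0 < K → 0 < τ → τ ≤ 1 →
      (∀ (cov : CovariantDerivative (𝓡 4) (EuclideanSpace ℝ (Fin 4)) (TangentSpace (𝓡 4) : M → Type _)),
        g₀.IsLeviCivita cov →
        ∀ (x : M) (e : Fin 4 → TangentSpace (𝓡 4) x), g₀.IsOrthonormalFrame x e →
          (g₀.blockA cov x e, g₀.blockB cov x e, g₀.blockC cov x e) ∈ pinchingSet m c K τ) →
      (∀ (T : ℝ)
        (g : ℝ → PseudoRiemannianMetric (𝓡 4) ∞ (EuclideanSpace ℝ (Fin 4))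
          (TangentSpace (𝓡 4) : M → Type _))
        (cov : ℝ → CovariantDerivative (𝓡 4) (EuclideanSpace ℝ (Fin 4))
          (TangentSpace (𝓡 4) : M → Type _)),
        IsRicciFlow g cov (Ico 0 T) → (∀ t ∈ Ico 0 T, (g t).IsRiemannian) → g 0 = g₀ →
        ∀ t ∈ Ico 0 T, ∀ (x : M) (e : Fin 4 → TangentSpace (𝓡 4) x),
          (g t).IsOrthonormalFrame x e →
            ((g t).blockA (cov t) x e, (g t).blockB (cov t) x e, (g t).blockC (cov t) x e) ∈
              pinchingSet m c K τ) →
      ∃ (k : ℝ) (g' : PseudoRiemannianMetric (𝓡 4) ∞ (EuclideanSpace ℝ (Fin 4))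
          (TangentSpace (𝓡 4) : M → Type _)),
        0 < k ∧ g'.IsRiemannian ∧ g'.HasConstantSectionalCurvature k := by
  sorry

/-- **STUB 5 — THE CHERN–GAUSS–BONNET FORMULA IN DIMENSION FOUR (named fact
`Literature.Geometry.Riemannian.chernGaussBonnet_four`, VERBATIM the leaf `hCGB` of
`changGurskyYang_sphere_four_of_chernGaussBonnet_of_margerin_of_thm14` (Euler file); classical XL debt,
already registered as STUB 5 of line `cgy-variance-pivot` of crux CompactShrinkerGap — same call site
`stub_chernGaussBonnetFour M g hg`).** `8π² χ(M) = ¼ (∫|W|² dV).toReal + ∫σ₂(A) dV` for every `C^∞`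
Riemannian metric on a closed smooth 4-manifold, `χ(M) = relEuler ℤ ℤ M ∅` (Chern 1944; Besse 1987,
6.31; CGY 2003 (1.1)); five equivalent forms in `ChernGaussBonnetFourForms.lean`, checked on the round
`S⁴`. Not lightened by this line; a route planner may promote it to a route item as was done for CGY.
[cite: Besse1987, 6.31] [cite: ChangGurskyYang2003, (1.1) p. 111] -/
theorem stub_chernGaussBonnetFour : chernGaussBonnet_four := by
  sorry

/-- **STUB 6 — CGY 2003 THEOREM 1.4 (`α = 1`) IN THE CONNECTED `scal > 0` SHAPE (= Disproof §7
`Thm14LeafPsc` = card gv-continuity-path's `thm14_gurskyViaclovsky` = card gv-weyl-shifted-path's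
`WeylShiftedGV`, VERBATIM).** On a closed CONNECTED smooth 4-manifold, a `C^∞` Riemannian `g₀` with
`R > 0` and `¼∫|W|² < ∫σ₂(A)` is conformal to a `C^∞` Riemannian `g` with `R > 0` and
`¼|W|² < σ₂(A)` POINTWISE. TRUE in print (CGY 2003 Thm. 1.4 with Aubin `scal > 0 ⇒ Y > 0` and p. 108
"in particular `R > 0`"; the tree proves `Thm14LeafConnected → Thm14LeafPsc`,
`thm14LeafPsc_of_connected`); the unconnected `hThm14` of the tree's reduction is PAPER-FALSE
(`S⁴ ⊔ S³×S¹`, Disproof §7 `thm14Leaf_false`) and is NOT used here. This is the σ₂ leaf — the line's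
Achilles heel, untouched by the lever: proof = [CGY1] (Annals 155 (2002)) δ-regularised fourth-order
equation + CGY 2003 §3 degree theory, or the Gursky–Viaclovsky positive-exponent continuity path with
the Weyl weight `ψ_W = ¼|W_g|²_g` carried as an `x`-term (cards gv-*, triage finding B: every GV estimate
survives the weight). XL-apex; no tree support beyond `sigma2WeylSchouten`, `IsConformalTo`,
`maclaurin_sigma2_four`. [cite: ChangGurskyYang2003, Thm. 1.4 (p. 112) and p. 108]
[cite: GurskyViaclovsky2003, Props. 4–6] -/
theorem stub_thm14Psc :
    ∀ (M : Type) [TopologicalSpace M] [T2Space M] [SecondCountableTopology M]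
      [ChartedSpace (EuclideanSpace ℝ (Fin 4)) M] [IsManifold (𝓡 4) ∞ M] [CompactSpace M]
      [ConnectedSpace M] [MeasurableSpace M] [BorelSpace M]
      (g₀ : PseudoRiemannianMetric (𝓡 4) ∞ (EuclideanSpace ℝ (Fin 4)) (TangentSpace (𝓡 4) : M → Type _))
      [g₀.HasLeviCivita] (hg₀ : g₀.IsRiemannian),
      (∀ x, 0 < g₀.scalarCurvature x) →
      1 / 4 * g₀.weylEnergy.toReal < g₀.sigma2WeylSchoutenIntegral →
      ∃ (g : PseudoRiemannianMetric (𝓡 4) ∞ (EuclideanSpace ℝ (Fin 4)) (TangentSpace (𝓡 4) : M → Type _))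
        (_ : g.HasLeviCivita) (hg : g.IsRiemannian),
        IsConformalTo (g.toContMDiffRiemannianMetric hg) (g₀.toContMDiffRiemannianMetric hg₀) ∧
        (∀ x, 0 < g.scalarCurvature x) ∧ ∀ x, 1 / 4 * g.weylNormSq x < g.sigma2WeylSchouten x := by
  sorry

/-! ## The compositions (kernel-checked, no `sorry`) -/

/-- **MARGERIN'S LEAF FROM STUBS 1–4** (= `hMargerin` of the tree's reduction, verbatim, incl.
`[ConnectedSpace M]` and the disjunction with `ℝP⁴` — honouring Disproof §3b): on a closed connected
4-manifold, `R > 0` and `WP < 1/6` pointwise give `M ≅ S⁴` or `M` a standard `ℝP⁴`. STUB 2 fits the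
initial blocks into `Z = pinchingSet m c K (σ/2)` with `σ = σ(c)` from STUB 1; STUB 3 (with `τ = σ/2 < σ`)
keeps every Ricci flow from `g` inside `Z`; STUB 4 produces a metric of constant sectional curvature
`k > 0`; Killing–Hopf (`killingHopf_quotient_four`, PROVED) and "the only free orthogonal quotient of
`S⁴` is `ℝP⁴`" (`nonempty_diffeomorph_or_isRealProjectiveSpace_of_orthogonal_quotient`, PROVED) finish.
[cite: Margerin1998, Thm. 1 (p. 21)] [cite: Hamilton1986, §5, 5.2 and p. 154] [cite: Lee2018, Thm. 12.4, Cor. 12.5] -/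
theorem margerin_of_stubs
    (h₁ : ∀ c : ℝ, 0 ≤ c → c < 1 / 6 → ∃ σ : ℝ, 0 < σ ∧ σ ≤ 1 ∧
      ∀ p ∈ margerinCone c, margerinP2 p ≤ -(σ * (devNormSq p * scal (field p))))
    (h₂ : ∀ (M : Type) [TopologicalSpace M] [T2Space M] [SecondCountableTopology M]
      [ChartedSpace (EuclideanSpace ℝ (Fin 4)) M] [IsManifold (𝓡 4) ∞ M] [CompactSpace M]
      (g : PseudoRiemannianMetric (𝓡 4) ∞ (EuclideanSpace ℝ (Fin 4)) (TangentSpace (𝓡 4) : M → Type _))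
      [g.HasLeviCivita], g.IsRiemannian → (∀ x, 0 < g.scalarCurvature x) →
      (∀ x, g.weakPinching x < 1 / 6) →
      ∃ m c : ℝ, 0 < m ∧ 0 < c ∧ c < 1 / 6 ∧ ∀ τ : ℝ, 0 ≤ τ → τ ≤ 1 → ∃ K : ℝ, 0 < K ∧
        ∀ (cov : CovariantDerivative (𝓡 4) (EuclideanSpace ℝ (Fin 4)) (TangentSpace (𝓡 4) : M → Type _)),
          g.IsLeviCivita cov →
          ∀ (x : M) (e : Fin 4 → TangentSpace (𝓡 4) x), g.IsOrthonormalFrame x e →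
            (g.blockA cov x e, g.blockB cov x e, g.blockC cov x e) ∈ pinchingSet m c K τ)
    (h₃ : ∀ (m c K σ τ : ℝ), 0 < m → 0 < c → c < 1 / 6 → 0 < K → 0 < τ → τ < σ → σ ≤ 1 →
      (∀ p ∈ margerinCone c, margerinP2 p ≤ -(σ * (devNormSq p * scal (field p)))) →
      ∀ (M : Type) [TopologicalSpace M] [T2Space M] [SecondCountableTopology M] [CompactSpace M]
        [ChartedSpace (EuclideanSpace ℝ (Fin 4)) M] [IsManifold (𝓡 4) ∞ M] (T : ℝ)
        (g : ℝ → PseudoRiemannianMetric (𝓡 4) ∞ (EuclideanSpace ℝ (Fin 4))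
          (TangentSpace (𝓡 4) : M → Type _))
        (cov : ℝ → CovariantDerivative (𝓡 4) (EuclideanSpace ℝ (Fin 4))
          (TangentSpace (𝓡 4) : M → Type _)),
        IsRicciFlow g cov (Ico 0 T) → (∀ t ∈ Ico 0 T, (g t).IsRiemannian) →
        (∀ (x : M) (e : Fin 4 → TangentSpace (𝓡 4) x), (g 0).IsOrthonormalFrame x e →
          ((g 0).blockA (cov 0) x e, (g 0).blockB (cov 0) x e, (g 0).blockC (cov 0) x e) ∈
            pinchingSet m c K τ) →
        ∀ t ∈ Ico 0 T, ∀ (x : M) (e : Fin 4 → TangentSpace (𝓡 4) x),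
          (g t).IsOrthonormalFrame x e →
            ((g t).blockA (cov t) x e, (g t).blockB (cov t) x e, (g t).blockC (cov t) x e) ∈
              pinchingSet m c K τ)
    (h₄ : ∀ (M : Type) [TopologicalSpace M] [T2Space M] [SecondCountableTopology M]
      [ChartedSpace (EuclideanSpace ℝ (Fin 4)) M] [IsManifold (𝓡 4) ∞ M] [CompactSpace M]
      [ConnectedSpace M]
      (g₀ : PseudoRiemannianMetric (𝓡 4) ∞ (EuclideanSpace ℝ (Fin 4)) (TangentSpace (𝓡 4) : M → Type _))
      (m c K τ : ℝ), g₀.IsRiemannian → 0 < m → 0 < c → c < 1 / 6 → 0 < K → 0 < τ → τ ≤ 1 →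
      (∀ (cov : CovariantDerivative (𝓡 4) (EuclideanSpace ℝ (Fin 4)) (TangentSpace (𝓡 4) : M → Type _)),
        g₀.IsLeviCivita cov →
        ∀ (x : M) (e : Fin 4 → TangentSpace (𝓡 4) x), g₀.IsOrthonormalFrame x e →
          (g₀.blockA cov x e, g₀.blockB cov x e, g₀.blockC cov x e) ∈ pinchingSet m c K τ) →
      (∀ (T : ℝ)
        (g : ℝ → PseudoRiemannianMetric (𝓡 4) ∞ (EuclideanSpace ℝ (Fin 4))
          (TangentSpace (𝓡 4) : M → Type _))
        (cov : ℝ → CovariantDerivative (𝓡 4) (EuclideanSpace ℝ (Fin 4))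
          (TangentSpace (𝓡 4) : M → Type _)),
        IsRicciFlow g cov (Ico 0 T) → (∀ t ∈ Ico 0 T, (g t).IsRiemannian) → g 0 = g₀ →
        ∀ t ∈ Ico 0 T, ∀ (x : M) (e : Fin 4 → TangentSpace (𝓡 4) x),
          (g t).IsOrthonormalFrame x e →
            ((g t).blockA (cov t) x e, (g t).blockB (cov t) x e, (g t).blockC (cov t) x e) ∈
              pinchingSet m c K τ) →
      ∃ (k : ℝ) (g' : PseudoRiemannianMetric (𝓡 4) ∞ (EuclideanSpace ℝ (Fin 4))
          (TangentSpace (𝓡 4) : M → Type _)),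
        0 < k ∧ g'.IsRiemannian ∧ g'.HasConstantSectionalCurvature k)
    (M : Type) [TopologicalSpace M] [T2Space M] [SecondCountableTopology M]
    [ChartedSpace (EuclideanSpace ℝ (Fin 4)) M] [IsManifold (𝓡 4) ∞ M] [CompactSpace M]
    [ConnectedSpace M]
    (g : PseudoRiemannianMetric (𝓡 4) ∞ (EuclideanSpace ℝ (Fin 4)) (TangentSpace (𝓡 4) : M → Type _))
    [g.HasLeviCivita] (hg : g.IsRiemannian) (hR : ∀ x, 0 < g.scalarCurvature x)
    (hWP : ∀ x, g.weakPinching x < 1 / 6) :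
    Nonempty (M ≃ₘ⟮𝓡 4, 𝓡 4⟯ 𝕊⁴) ∨ IsRealProjectiveSpace 4 M := by
  -- STUB 2: initial fit `m, c`, and for each `τ` a `K`
  obtain ⟨m, c, hm, hc0, hc, hfit⟩ := h₂ M g hg hR hWP
  -- STUB 1: the margin `σ = σ(c)`; the line runs with `τ = σ/2 < σ`
  obtain ⟨σ, hσ0, hσ1, hpoly⟩ := h₁ c hc0.le hc
  have hτ0 : 0 < σ / 2 := by positivity
  have hτσ : σ / 2 < σ := by linarith
  have hτ1 : σ / 2 ≤ 1 := by linarith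
  obtain ⟨K, hK, hfitK⟩ := hfit (σ / 2) hτ0.le hτ1
  -- STUB 3: every Ricci flow of Riemannian metrics starting at `g` stays in `Z = pinchingSet m c K (σ/2)`
  have hpres : ∀ (T : ℝ)
      (gt : ℝ → PseudoRiemannianMetric (𝓡 4) ∞ (EuclideanSpace ℝ (Fin 4))
        (TangentSpace (𝓡 4) : M → Type _))
      (cov : ℝ → CovariantDerivative (𝓡 4) (EuclideanSpace ℝ (Fin 4))
        (TangentSpace (𝓡 4) : M → Type _)),
      IsRicciFlow gt cov (Ico 0 T) → (∀ t ∈ Ico 0 T, (gt t).IsRiemannian) → gt 0 = g →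
      ∀ t ∈ Ico 0 T, ∀ (x : M) (e : Fin 4 → TangentSpace (𝓡 4) x),
        (gt t).IsOrthonormalFrame x e →
          ((gt t).blockA (cov t) x e, (gt t).blockB (cov t) x e, (gt t).blockC (cov t) x e) ∈
            pinchingSet m c K (σ / 2) := by
    intro T gt cov hflow hRiem h0 t ht x e he
    have hT : (0 : ℝ) ∈ Ico 0 T := ⟨le_rfl, lt_of_le_of_lt ht.1 ht.2⟩
    have hLC : (gt 0).IsLeviCivita (cov 0) := hflow.isLeviCivita 0 hT
    refine h₃ m c K σ (σ / 2) hm hc0 hc hK hτ0 hτσ hσ1 hpoly M T gt cov hflow hRiem ?_ t ht x e he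
    intro y f hf
    subst h0
    exact hfitK (cov 0) hLC y f hf
  -- STUB 4: a metric of constant sectional curvature `k > 0` on `M`
  obtain ⟨k, g', hk, hg', hconst⟩ :=
    h₄ M g m c K (σ / 2) hg hm hc0 hc hK hτ0 hτ1 hfitK hpres
  -- Killing–Hopf (PROVED) and the classification of free orthogonal quotients of `S⁴` (PROVED)
  obtain ⟨Γ, q, hfree, hq, hsurj, hfib⟩ := killingHopf_quotient_four M k g' hk hg' hconst
  exact nonempty_diffeomorph_or_isRealProjectiveSpace_of_orthogonal_quotient ⟨2, rfl⟩ hfree hq hsurj hfib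

/-- **THE SKELETON THEOREM — the crux `EntropyRung.ChangGurskyYang` BY NAME, its proof calling the six
registered stubs** (CGY 2003 §2, p. 121, line by line; the glue itself is `ChangGurskyYang_of_hypotheses`
below, kernel-checked WITHOUT `sorry`; this theorem inherits the stubs' `sorry`s by design and closes the
crux the moment they land): `(0.3) ⇒ (1.2)` by Chern–Gauss–Bonnet (`stub_chernGaussBonnetFour`) and
`χ(M) ≥ 2` (PROVED); CGY Thm. 1.4, connected psc shape (`stub_thm14Psc`) ⇒ conformal `g'` with `R > 0`,
`¼|W|² < σ₂(A)` pointwise ⇒ `WP < 1/6` (PROVED rearrangement); Margerin's leaf from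
`stub_margerinPolynomial`, `stub_initialFit`, `stub_pinchingPreserved`, `stub_pinchedFlowConvergence`
(`margerin_of_stubs`) ⇒ `S⁴ ∨ ℝP⁴`; `π₁ = 1` discards `ℝP⁴` (PROVED).
[cite: ChangGurskyYang2003, §2, p. 121] [cite: Margerin1998, Thm. 1] -/
theorem ChangGurskyYang_of : ChangGurskyYang := by
  rintro M _ _ _ _ _ _ _ ⟨g, _, hgR, hscal, hW⟩
  letI : MeasurableSpace M := borel M
  haveI : BorelSpace M := ⟨rfl⟩
  have hE : finrank ℝ (EuclideanSpace ℝ (Fin 4)) = 4 := finrank_euclideanSpace_fin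
  -- (0.3) ⇒ (1.2): Chern–Gauss–Bonnet (STUB 5) and `χ(M) ≥ 2` (PROVED)
  have h12 : 1 / 4 * g.weylEnergy.toReal < g.sigma2WeylSchoutenIntegral :=
    quarter_weylEnergy_lt_of_chernGaussBonnet g hgR (stub_chernGaussBonnetFour M g hgR) hW
  -- Thm. 1.4, connected psc shape (STUB 6)
  obtain ⟨g', _, hg'R, -, hscal', hpt⟩ := stub_thm14Psc M g hgR hscal h12
  have hpos' : ∀ (x : M) (v : TangentSpace (𝓡 4) x), v ≠ 0 → 0 < g'.val x v v :=
    fun x v hv ↦ hg'R x v hv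
  -- "rearranging terms": `WP < 1/6` pointwise (PROVED)
  have hWP : ∀ x, g'.weakPinching x < 1 / 6 := fun x ↦
    g'.weakPinching_lt_of_sigma2WeylSchouten_gt (WithTop.coe_le_coe.mpr le_top) hE (hpos' x) (hpt x)
  -- Margerin's leaf from STUBS 1–4 (+ Killing–Hopf, PROVED): `S⁴ ∨ ℝP⁴`; `π₁ = 1` excludes `ℝP⁴`
  rcases margerin_of_stubs stub_margerinPolynomial stub_initialFit stub_pinchingPreserved
      stub_pinchedFlowConvergence M g' hg'R hscal' hWP with h | h
  · exact h
  · exact absurd ‹SimplyConnectedSpace M› (h.not_simplyConnectedSpace (by norm_num))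

/-- **The same skeleton theorem for the item's OTHER route decl `WeylBudget.ChangGurskyYang`** (rank 9 of
route WeylBudget; the two route decls are the same proposition, `Iff.rfl` — Disproof §1
`weylBudget_crux_iff`), so that `ledger skeleton check` finds the crux by name under either route.
[cite: ChangGurskyYang2003, Thm. A] -/
theorem ChangGurskyYang_of_weylBudget :
    Summit.SmoothPoincare4.SmoothPoincare4.Theses.WeylBudget.ChangGurskyYang :=
  ChangGurskyYang_of

/-- **THE COMPOSITION IN HYPOTHESIS FORM (sorry-free kernel certificate of the glue; axioms
`propext`, `Classical.choice`, `Quot.sound`)** — the crux `EntropyRung.ChangGurskyYang` from the six stub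
STATEMENTS as hypotheses (CGY 2003 §2, p. 121, line by line): `(0.3) ⇒ (1.2)` by Chern–Gauss–Bonnet
(STUB 5) and `χ(M) ≥ 2` for closed simply connected `M` (`quarter_weylEnergy_lt_of_chernGaussBonnet`, the
Euler-characteristic half PROVED in the tree); Thm. 1.4 in the connected psc shape (STUB 6) gives a
conformal metric with `R > 0` and `¼|W|² < σ₂(A)` pointwise; "rearranging terms"
(`weakPinching_lt_of_sigma2WeylSchouten_gt`, PROVED) gives `WP < 1/6`; Margerin's leaf from STUBS 1–4
(`margerin_of_stubs`) gives `S⁴ ∨ ℝP⁴`; `π₁ = 1` discards `ℝP⁴`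
(`IsRealProjectiveSpace.not_simplyConnectedSpace`, PROVED). `ChangGurskyYang_of` above is this theorem
applied to the registered stubs. [cite: ChangGurskyYang2003, §2, p. 121] [cite: Margerin1998, Thm. 1] -/
theorem ChangGurskyYang_of_hypotheses :
    (∀ c : ℝ, 0 ≤ c → c < 1 / 6 → ∃ σ : ℝ, 0 < σ ∧ σ ≤ 1 ∧
      ∀ p ∈ margerinCone c, margerinP2 p ≤ -(σ * (devNormSq p * scal (field p)))) →
    (∀ (M : Type) [TopologicalSpace M] [T2Space M] [SecondCountableTopology M]
      [ChartedSpace (EuclideanSpace ℝ (Fin 4)) M] [IsManifold (𝓡 4) ∞ M] [CompactSpace M]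
      (g : PseudoRiemannianMetric (𝓡 4) ∞ (EuclideanSpace ℝ (Fin 4)) (TangentSpace (𝓡 4) : M → Type _))
      [g.HasLeviCivita], g.IsRiemannian → (∀ x, 0 < g.scalarCurvature x) →
      (∀ x, g.weakPinching x < 1 / 6) →
      ∃ m c : ℝ, 0 < m ∧ 0 < c ∧ c < 1 / 6 ∧ ∀ τ : ℝ, 0 ≤ τ → τ ≤ 1 → ∃ K : ℝ, 0 < K ∧
        ∀ (cov : CovariantDerivative (𝓡 4) (EuclideanSpace ℝ (Fin 4)) (TangentSpace (𝓡 4) : M → Type _)),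
          g.IsLeviCivita cov →
          ∀ (x : M) (e : Fin 4 → TangentSpace (𝓡 4) x), g.IsOrthonormalFrame x e →
            (g.blockA cov x e, g.blockB cov x e, g.blockC cov x e) ∈ pinchingSet m c K τ) →
    (∀ (m c K σ τ : ℝ), 0 < m → 0 < c → c < 1 / 6 → 0 < K → 0 < τ → τ < σ → σ ≤ 1 →
      (∀ p ∈ margerinCone c, margerinP2 p ≤ -(σ * (devNormSq p * scal (field p)))) →
      ∀ (M : Type) [TopologicalSpace M] [T2Space M] [SecondCountableTopology M] [CompactSpace M]
        [ChartedSpace (EuclideanSpace ℝ (Fin 4)) M] [IsManifold (𝓡 4) ∞ M] (T : ℝ)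
        (g : ℝ → PseudoRiemannianMetric (𝓡 4) ∞ (EuclideanSpace ℝ (Fin 4))
          (TangentSpace (𝓡 4) : M → Type _))
        (cov : ℝ → CovariantDerivative (𝓡 4) (EuclideanSpace ℝ (Fin 4))
          (TangentSpace (𝓡 4) : M → Type _)),
        IsRicciFlow g cov (Ico 0 T) → (∀ t ∈ Ico 0 T, (g t).IsRiemannian) →
        (∀ (x : M) (e : Fin 4 → TangentSpace (𝓡 4) x), (g 0).IsOrthonormalFrame x e →
          ((g 0).blockA (cov 0) x e, (g 0).blockB (cov 0) x e, (g 0).blockC (cov 0) x e) ∈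
            pinchingSet m c K τ) →
        ∀ t ∈ Ico 0 T, ∀ (x : M) (e : Fin 4 → TangentSpace (𝓡 4) x),
          (g t).IsOrthonormalFrame x e →
            ((g t).blockA (cov t) x e, (g t).blockB (cov t) x e, (g t).blockC (cov t) x e) ∈
              pinchingSet m c K τ) →
    (∀ (M : Type) [TopologicalSpace M] [T2Space M] [SecondCountableTopology M]
      [ChartedSpace (EuclideanSpace ℝ (Fin 4)) M] [IsManifold (𝓡 4) ∞ M] [CompactSpace M]
      [ConnectedSpace M]
      (g₀ : PseudoRiemannianMetric (𝓡 4) ∞ (EuclideanSpace ℝ (Fin 4)) (TangentSpace (𝓡 4) : M → Type _))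
      (m c K τ : ℝ), g₀.IsRiemannian → 0 < m → 0 < c → c < 1 / 6 → 0 < K → 0 < τ → τ ≤ 1 →
      (∀ (cov : CovariantDerivative (𝓡 4) (EuclideanSpace ℝ (Fin 4)) (TangentSpace (𝓡 4) : M → Type _)),
        g₀.IsLeviCivita cov →
        ∀ (x : M) (e : Fin 4 → TangentSpace (𝓡 4) x), g₀.IsOrthonormalFrame x e →
          (g₀.blockA cov x e, g₀.blockB cov x e, g₀.blockC cov x e) ∈ pinchingSet m c K τ) →
      (∀ (T : ℝ)
        (g : ℝ → PseudoRiemannianMetric (𝓡 4) ∞ (EuclideanSpace ℝ (Fin 4))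
          (TangentSpace (𝓡 4) : M → Type _))
        (cov : ℝ → CovariantDerivative (𝓡 4) (EuclideanSpace ℝ (Fin 4))
          (TangentSpace (𝓡 4) : M → Type _)),
        IsRicciFlow g cov (Ico 0 T) → (∀ t ∈ Ico 0 T, (g t).IsRiemannian) → g 0 = g₀ →
        ∀ t ∈ Ico 0 T, ∀ (x : M) (e : Fin 4 → TangentSpace (𝓡 4) x),
          (g t).IsOrthonormalFrame x e →
            ((g t).blockA (cov t) x e, (g t).blockB (cov t) x e, (g t).blockC (cov t) x e) ∈
              pinchingSet m c K τ) →
      ∃ (k : ℝ) (g' : PseudoRiemannianMetric (𝓡 4) ∞ (EuclideanSpace ℝ (Fin 4))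
          (TangentSpace (𝓡 4) : M → Type _)),
        0 < k ∧ g'.IsRiemannian ∧ g'.HasConstantSectionalCurvature k) →
    chernGaussBonnet_four →
    (∀ (M : Type) [TopologicalSpace M] [T2Space M] [SecondCountableTopology M]
      [ChartedSpace (EuclideanSpace ℝ (Fin 4)) M] [IsManifold (𝓡 4) ∞ M] [CompactSpace M]
      [ConnectedSpace M] [MeasurableSpace M] [BorelSpace M]
      (g₀ : PseudoRiemannianMetric (𝓡 4) ∞ (EuclideanSpace ℝ (Fin 4)) (TangentSpace (𝓡 4) : M → Type _))
      [g₀.HasLeviCivita] (hg₀ : g₀.IsRiemannian),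
      (∀ x, 0 < g₀.scalarCurvature x) →
      1 / 4 * g₀.weylEnergy.toReal < g₀.sigma2WeylSchoutenIntegral →
      ∃ (g : PseudoRiemannianMetric (𝓡 4) ∞ (EuclideanSpace ℝ (Fin 4)) (TangentSpace (𝓡 4) : M → Type _))
        (_ : g.HasLeviCivita) (hg : g.IsRiemannian),
        IsConformalTo (g.toContMDiffRiemannianMetric hg) (g₀.toContMDiffRiemannianMetric hg₀) ∧
        (∀ x, 0 < g.scalarCurvature x) ∧ ∀ x, 1 / 4 * g.weylNormSq x < g.sigma2WeylSchouten x) →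
    ChangGurskyYang := by
  intro h₁ h₂ h₃ h₄ hCGB h14
  rintro M _ _ _ _ _ _ _ ⟨g, _, hgR, hscal, hW⟩
  letI : MeasurableSpace M := borel M
  haveI : BorelSpace M := ⟨rfl⟩
  have hE : finrank ℝ (EuclideanSpace ℝ (Fin 4)) = 4 := finrank_euclideanSpace_fin
  -- (0.3) ⇒ (1.2): Chern–Gauss–Bonnet (STUB 5) and `χ(M) ≥ 2` (PROVED) give `¼∫|W|² < ∫σ₂(A)`
  have h12 : 1 / 4 * g.weylEnergy.toReal < g.sigma2WeylSchoutenIntegral :=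
    quarter_weylEnergy_lt_of_chernGaussBonnet g hgR (hCGB M g hgR) hW
  -- Thm. 1.4 (connected, psc shape; STUB 6): a conformal `g'` with `R > 0` and `¼|W|² < σ₂(A)` pointwise
  obtain ⟨g', _, hg'R, -, hscal', hpt⟩ := h14 M g hgR hscal h12
  have hpos' : ∀ (x : M) (v : TangentSpace (𝓡 4) x), v ≠ 0 → 0 < g'.val x v v :=
    fun x v hv ↦ hg'R x v hv
  -- "rearranging terms": `WP < 1/6` pointwise
  have hWP : ∀ x, g'.weakPinching x < 1 / 6 := fun x ↦
    g'.weakPinching_lt_of_sigma2WeylSchouten_gt (WithTop.coe_le_coe.mpr le_top) hE (hpos' x) (hpt x)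
  -- Margerin's leaf from STUBS 1–4: `S⁴` or `ℝP⁴`; `π₁ = 1` excludes `ℝP⁴`
  rcases margerin_of_stubs h₁ h₂ h₃ h₄ M g' hg'R hscal' hWP with h | h
  · exact h
  · exact absurd ‹SimplyConnectedSpace M› (h.not_simplyConnectedSpace (by norm_num))


/-- **Signature certificate**: the registered stubs are EXACTLY the hypotheses of
`ChangGurskyYang_of_hypotheses` (this term typechecks iff every stub statement matches the corresponding
hypothesis symbol for symbol). [folklore] -/
theorem changGurskyYang_of_stubs : ChangGurskyYang :=
  ChangGurskyYang_of_hypotheses stub_margerinPolynomial stub_initialFit stub_pinchingPreserved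
    stub_pinchedFlowConvergence stub_chernGaussBonnetFour stub_thm14Psc

/-! ## Sanity lemmas on the vocabulary (kernel-checked; cheap guards against mis-normalisation) -/

/-- The deviation vanishes on the identity ray (round `S⁴`: `A = C = λ·1`, `B = 0`). [folklore] -/
theorem devNormSq_idRay (l : ℝ) :
    devNormSq (l • (1 : Matrix (Fin 3) (Fin 3) ℝ), 0, l • (1 : Matrix (Fin 3) (Fin 3) ℝ)) = 0 := by
  simp [devNormSq, rmNormSq, frobSq, scal, Matrix.trace, Matrix.one_apply]
  ring

/-- The round cylinder `S³ × ℝ` (unit `S³`; blocks `(1, 1, 1)` up to the sign of `B`) sits EXACTLY on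
the boundary of the `45°` cone: `R = 6`, `|𝒟|² = 6 = R²/6`, `WP = 1/6` (CGY p. 106: Theorem A is sharp).
[cite: ChangGurskyYang2003, p. 106] -/
theorem devNormSq_cylinder :
    scal ((1 : Matrix (Fin 3) (Fin 3) ℝ), (1 : Matrix (Fin 3) (Fin 3) ℝ), (1 : Matrix (Fin 3) (Fin 3) ℝ)) = 6 ∧
    devNormSq ((1 : Matrix (Fin 3) (Fin 3) ℝ), (1 : Matrix (Fin 3) (Fin 3) ℝ), (1 : Matrix (Fin 3) (Fin 3) ℝ)) = 6 := by
  constructor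
  · simp [scal, Matrix.trace]
    norm_num
  · simp [devNormSq, rmNormSq, frobSq, scal, Matrix.trace, Matrix.one_apply]
    norm_num

/-- The identity ray `(λ·1, 0, λ·1)` with `λ > 0` (the curvature of a round `S⁴`, `R = 6λ`) lies in every
pinching set with `m ≤ 6λ`, `c, K ≥ 0`: the sets are non-empty and contain the whole future of round data
under the ODE (`λ' = 3λ²`). [folklore] -/
theorem idRay_mem_pinchingSet {m c K τ l : ℝ} (hc : 0 ≤ c) (hK : 0 ≤ K) (hl : 0 < l) (hm : m ≤ 6 * l) :
    (l • (1 : Matrix (Fin 3) (Fin 3) ℝ), (0 : Matrix (Fin 3) (Fin 3) ℝ), l • (1 : Matrix (Fin 3) (Fin 3) ℝ)) ∈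
      pinchingSet m c K τ := by
  have hdev := devNormSq_idRay l
  have hscal : scal (l • (1 : Matrix (Fin 3) (Fin 3) ℝ), (0 : Matrix (Fin 3) (Fin 3) ℝ),
      l • (1 : Matrix (Fin 3) (Fin 3) ℝ)) = 6 * l := by
    simp [scal, Matrix.trace]
    ring
  refine ⟨⟨?_, ?_, rfl, ?_, ?_⟩, ?_, ?_⟩
  · exact (Matrix.isSymm_one).smul l
  · exact (Matrix.isSymm_one).smul l
  · rw [hscal]; positivity
  · rw [hdev]; positivity
  · simpa [hscal] using hm
  · rw [hdev]
    exact mul_nonneg hK (Real.rpow_nonneg (by rw [hscal]; positivity) _)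

end Summit.SmoothPoincare4.SmoothPoincare4.Cruxes.ChangGurskyYang.MargerinConeHamiltonRails

end
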